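import Mathlib
import Summits.AtomisticToContinuum.Crystallization.Theorems.ChessboardParticlePlanesLjLaminarWindowsGlueC5
import HarnessLib

/-! # Geometric growth along spiky scales — stub `stub_spikyGrowth` of line `Sketch` (skeleton rev. 10, lead c6), crux `LjLaminarWindows` (stmt-AtomisticToContinuum-6711) -/

noncomputable section

open scoped BigOperators
open Filter Topology
open Literature.MathematicalPhysics.StatisticalMechanics
open Summit.AtomisticToContinuum.Crystallization.Theorems.ChargedEnergyGapNegative

namespace Summit.AtomisticToContinuum.Crystallization.Theorems.LjLaminarWindowsSketch

/-- Inductive core of `stub_spikyGrowth`: the geometric-growth bound for every nonempty finite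
`R`-separated set of `κ`-spiky scales, by induction on the maximum (`Finset.induction_on_max`).
[folklore] -/
theorem spikyGrowth_aux (F : ℝ → ℝ) (hF : Monotone F) (κ R : ℝ) (hκ1 : κ < 1)
    (s : Finset ℝ) :
    ∀ hne : s.Nonempty,
      (∀ L ∈ s, ∀ L' ∈ s, L ≠ L' → R ≤ |L - L'|) →
      (∀ L ∈ s, κ * F L < F L - F (L - R)) →
      F (s.min' hne) ≤ (1 - κ) ^ (s.card - 1) * F (s.max' hne) := by
  induction s using Finset.induction_on_max with
  | empty => intro hne; exact absurd hne Finset.not_nonempty_empty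
  | insert a s ha ih =>
    intro hne hsep hsp
    have ha_notin : a ∉ s := fun h => lt_irrefl a (ha a h)
    have hmax : (insert a s).max' hne = a := by
      apply le_antisymm
      · apply Finset.max'_le
        intro y hy
        rcases Finset.mem_insert.mp hy with rfl | hy
        · exact le_rfl
        · exact (ha y hy).le
      · exact Finset.le_max' _ _ (Finset.mem_insert_self a s)
    rcases s.eq_empty_or_nonempty with rfl | hs
    · have hmin : (insert a (∅ : Finset ℝ)).min' hne = a := by
        apply le_antisymm
        · exact Finset.min'_le _ _ (Finset.mem_insert_self a _)
        · apply Finset.le_min'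
          intro y hy
          rcases Finset.mem_insert.mp hy with rfl | hy
          · exact le_rfl
          · exact absurd hy (Finset.notMem_empty y)
      rw [hmax, hmin, Finset.card_insert_of_notMem ha_notin, Finset.card_empty]
      simp
    · have hmin : (insert a s).min' hne = s.min' hs := by
        apply le_antisymm
        · exact Finset.min'_le _ _ (Finset.mem_insert_of_mem (Finset.min'_mem s hs))
        · apply Finset.le_min'
          intro y hy
          rcases Finset.mem_insert.mp hy with rfl | hy
          · exact ((Finset.min'_le s _ (Finset.max'_mem s hs)).trans_lt
              (ha _ (Finset.max'_mem s hs))).le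
          · exact Finset.min'_le s y hy
      have hcard : (insert a s).card = s.card + 1 := Finset.card_insert_of_notMem ha_notin
      have hM'mem : s.max' hs ∈ s := Finset.max'_mem s hs
      have hM'lt : s.max' hs < a := ha _ hM'mem
      have hsepM : R ≤ |a - s.max' hs| :=
        hsep a (Finset.mem_insert_self a s) (s.max' hs) (Finset.mem_insert_of_mem hM'mem)
          (ne_of_gt hM'lt)
      have hM'le : s.max' hs ≤ a - R := by
        rw [abs_of_pos (sub_pos.mpr hM'lt)] at hsepM
        linarith
      have ih' := ih hs
        (fun L hL L' hL' hLL' =>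
          hsep L (Finset.mem_insert_of_mem hL) L' (Finset.mem_insert_of_mem hL') hLL')
        (fun L hL => hsp L (Finset.mem_insert_of_mem hL))
      have hmono : F (s.max' hs) ≤ F (a - R) := hF hM'le
      have hspa : F (a - R) ≤ (1 - κ) * F a := by
        have h := hsp a (Finset.mem_insert_self a s)
        rw [sub_mul, one_mul]
        linarith
      have hpos : (0 : ℝ) ≤ (1 - κ) ^ (s.card - 1) := pow_nonneg (by linarith) _
      have hcs : 1 ≤ s.card := Finset.card_pos.mpr hs
      rw [hmax, hmin, hcard, Nat.add_sub_cancel]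
      calc F (s.min' hs) ≤ (1 - κ) ^ (s.card - 1) * F (s.max' hs) := ih'
        _ ≤ (1 - κ) ^ (s.card - 1) * F (a - R) := mul_le_mul_of_nonneg_left hmono hpos
        _ ≤ (1 - κ) ^ (s.card - 1) * ((1 - κ) * F a) := mul_le_mul_of_nonneg_left hspa hpos
        _ = (1 - κ) ^ s.card * F a := by
          rw [← mul_assoc, ← pow_succ, Nat.sub_add_cancel hcs]

/-- **C6b — geometric growth along spiky scales** (provable now, pure real analysis): if a monotone
`F : ℝ → ℝ` gains more than a `κ`-fraction within the last `R` at every point of a finite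
`R`-separated set `Λ`, then `F (min Λ) ≤ (1 − κ)^(#Λ − 1) · F (max Λ)`. [folklore] -/
theorem stub_spikyGrowth :
    ∀ (F : ℝ → ℝ), Monotone F → ∀ κ R : ℝ, 0 < κ → κ < 1 → 0 < R →
      ∀ (Λ : Finset ℝ) (hΛ : Λ.Nonempty),
        (∀ L ∈ Λ, ∀ L' ∈ Λ, L ≠ L' → R ≤ |L - L'|) →
        (∀ L ∈ Λ, κ * F L < F L - F (L - R)) →
        F (Λ.min' hΛ) ≤ (1 - κ) ^ (Λ.card - 1) * F (Λ.max' hΛ) := by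
  intro F hF κ R _hκ hκ1 _hR Λ hΛ hsep hsp
  exact spikyGrowth_aux F hF κ R hκ1 Λ hΛ hsep hsp

end Summit.AtomisticToContinuum.Crystallization.Theorems.LjLaminarWindowsSketch

end
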